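/-
Copyright (c) 2026 the pub-hodgecm-mathlib formalisation cell (harness21).  Prover seat hodgecm-mathlib-LH4-p05 (g0): Track A «(D-RAM) FOUR-FRAME» squad of crux H413
(dealer LH4-plan (g10) WORD #29 ∕ heir LEAD F0P3a-plan (g19) T18-07 (3): «(f) `stub_U2H_leviRow_wild` → p05», HOME census v2 §E, brick L2), 2026-09-03.
The `|2|`-free twin of ★ `LineStrataMeasureRamified` (F0P3a-p07 (g12), road «S3-ram»): statements and proofs VERBATIM with `h2w : |2|_w = 1` replaced by an anti-fixed uniformiser.
-/
import Literature.NumberTheory.Automorphic.LineStrataMeasureRamified                 -- ★ the TAME file (shape of record): `valued_skew_apply_lt_one_of_ramified (he) (h2w)` and the five strata lemmas; brings ★ FILE 1 `LineStrataMeasure`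
import Literature.NumberTheory.LocalFields.RamifiedPlaceFixedValuationParity          -- ★ L1 (this seat): `valued_lt_one_of_complexConj_eq_neg_of_uniformizer` — the integral skew line lies in `𝔪_w`, `|2|`-free
import HarnessLib

/-!
# The line strata of `N₂ ∩ K₂` at a ramified non-split place WITH AN ANTI-FIXED UNIFORMISER — `|2|_w = 1` dropped
(Rogawski 1990 §4.9; Kottwitz 1986 §3; Serre, *Local Fields* IV §2)

Topic `NumberTheory/Automorphic`; namespace `Literature.NumberTheory.Automorphic.UnitaryGroup` (as ★ `LineStrataMeasureRamified`).  THEOREMS ONLY (no definition, no instance,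
no notation, no named fact, no `sorry`).  Cell `pub/hodgecm-mathlib`, crux H413 = `stmt-HodgeConjecture-24833` (count-neutral), Track A «(D-RAM) FOUR-FRAME», unit U2H children
(f) `stub_U2H_leviRow_wild` ∕ (e) `stub_U2H_typeTwoRow_wild` (LH4-p05 (g0) census v2 8155187a2585211d §B: the WILD port of the tame Levi ∕ type-(2) ★ stock splits by dyadic
TYPE; this file serves the TYPE-ODD half — places carrying an anti-fixed uniformiser `θ`, `σ_w θ = −θ`, `v_w θ = exp(−1)`: every tamely ramified place (★
`exists_uniformizer_galAdicCompletionMap_complexConj_eq_neg_of_ramified`) and the wild places `L_w = L⁺_v(√(u·π))`).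

THE MATHEMATICS = ★ `LineStrataMeasureRamified` VERBATIM with ONE input swapped: the root «an integral skew element of `L_w` lies in `𝔪_w`» is taken from ★ L1
`RamifiedPlaceFixedValuationParity.valued_lt_one_of_complexConj_eq_neg_of_uniformizer` (anti-fixed ⇒ odd order, by Galois descent and `e(w|v) = 2`) instead of
`σ_w ≡ id (mod 𝔪_w)` + `|2|_w = 1`.  Hence, at such a place: every `n ∈ N₂ ∩ K₂` has `rank(red(n_w) − 1) = 0`, the rank-1 line stratum is EMPTY and the rank-0 stratum is
all of `N₂ ∩ K₂` — for EVERY measure on `N₂`.  At the other wild type (`L_w = L⁺_v(√u)`, an anti-fixed UNIT exists) these statements are FALSE (the rank-1 stratum has positive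
measure); that half needs its own file.
* `valued_skew_apply_lt_one_of_ramified_of_uniformizer` (root), `rank_redMat_unipotent_sub_one_eq_zero_of_ramified_of_uniformizer`,
  `lineStratum_one_eq_empty_of_ramified_of_uniformizer`, `lineStratum_zero_eq_of_ramified_of_uniformizer`, `measureReal_lineStratum_one_of_ramified_of_uniformizer`,
  `measureReal_lineStratum_zero_of_ramified_of_uniformizer` — binders = ★ tame VERBATIM with `(h2w)` ↦ `{θ} (hθ) (hσθ)`.

HONEST LABEL: HC_CM is proved only modulo the 7 printed citations (2 remaining named inputs: hLiu418 = `stmt-HodgeConjecture-24832`, h413 = `stmt-HodgeConjecture-24833`) until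
rung 0 closes; this file is unconditional, asserts nothing printed and freezes no stub text.

## References
* [Rogawski1990] J. D. Rogawski, *Automorphic Representations of Unitary Groups in Three Variables*, Ann. of Math. Stud. 123 (1990), §1.10 p. 9; §4.9 p. 54.
* [Kottwitz1986] R. E. Kottwitz, *Base change for unit elements of Hecke algebras*, Compositio Math. 60 (1986), §3.
* [SerreLocalFields1979] J.-P. Serre, *Local Fields*, GTM 67 (1979), Ch. IV §2 Prop. 5.
-/

set_option autoImplicit false

noncomputable section

open MeasureTheory Measure Set Filter Topology NumberField IsDedekindDomain Matrix ValuativeRel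
open scoped ENNReal NNReal ValuativeRel Matrix MatrixGroups

namespace Literature.NumberTheory.Automorphic.UnitaryGroup

open Literature.NumberTheory.Automorphic Literature.NumberTheory.Automorphic.IntegralReduction
open Literature.NumberTheory.Automorphic.UnitaryGroup.HeisRing Literature.NumberTheory.Automorphic.UnitaryGroup.LineRing
open Literature.NumberTheory.Automorphic.Liu2021.LemD1IndexedNonVacuityRamifiedConverse

variable (L : Type) [Field L] [NumberField L] [IsCMField L] (v : HeightOneSpectrum (𝓞 ↥(maximalRealSubfield L)))
  (w : PlacesOver L v) (hw : IsCMField.complexConj L • w.1 = w.1)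

include hw in
/-- **THE INTEGRAL SKEW LINE LIES IN `𝔪_w` AT A RAMIFIED PLACE WITH AN ANTI-FIXED UNIFORMISER** (`|2|`-free): for `y ∈ R⁻` (`σy = −y`) with `|y_w| ≤ 1`, `|y_w| < 1` —
`y_w` is `σ_w`-anti-fixed (★ `conjLocal_apply_eq_of_smul_eq`), hence of odd order or zero (★ L1 `valued_lt_one_of_complexConj_eq_neg_of_uniformizer`: `y_w θ` is fixed, so of even
order by Galois descent and `e(w|v) = 2`). [cite: SerreLocalFields1979, Ch. IV §2 Prop. 5] [cite: Rogawski1990, §1.10 p. 9] -/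
theorem valued_skew_apply_lt_one_of_ramified_of_uniformizer (he : v.asIdeal.ramificationIdx' w.1.asIdeal ≠ 1) {θ : w.1.adicCompletion L} (hθ : Valued.v θ = WithZero.exp (-1 : ℤ))
    (hσθ : galAdicCompletionMap (L := L) (IsCMField.complexConj L) hw θ = -θ)
    (y : ↥(HeisRing.skewPart (conjLocal L (IsCMField.complexConj L) v))) (hy : Valued.v ((y : LocalRing L v) w) ≤ 1) :
    Valued.v ((y : LocalRing L v) w) < 1 := by
  haveI : Algebra.IsQuadraticExtension ↥(maximalRealSubfield L) L := IsCMField.isQuadraticExtension L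
  have hσ : galAdicCompletionMap (L := L) (IsCMField.complexConj L) hw ((y : LocalRing L v) w) = -((y : LocalRing L v) w) := by
    rw [← conjLocal_apply_eq_of_smul_eq (IsCMField.complexConj L) (IsCMField.complexConj_ne_one L) v w hw, (mem_skewPart_iff _ _).1 y.2, Pi.neg_apply]
  exact Literature.NumberTheory.LocalFields.RamifiedPlaceFixedValuationParity.valued_lt_one_of_complexConj_eq_neg_of_uniformizer L w hw he hθ hσθ hy hσ

include hw in
/-- **AT A RAMIFIED PLACE WITH AN ANTI-FIXED UNIFORMISER, EVERY `n ∈ N₂ ∩ K₂` HAS `rank(red(n_w) − 1) = 0`** (`|2|`-free) (`n = [[1, y], [0, 1]]`, `y ∈ 𝒪⁻ ⊆ 𝔪_w`, ★ FILE 1 `rank_redMat_unipotent_sub_one_eq_zero_iff`).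
[cite: Rogawski1990, §4.9 p. 54] [cite: Kottwitz1986, §3] -/
theorem rank_redMat_unipotent_sub_one_eq_zero_of_ramified_of_uniformizer (he : v.asIdeal.ramificationIdx' w.1.asIdeal ≠ 1) {θ : w.1.adicCompletion L} (hθ : Valued.v θ = WithZero.exp (-1 : ℤ))
    (hσθ : galAdicCompletionMap (L := L) (IsCMField.complexConj L) hw θ = -θ)
    (n : ↥(cmBorelTriple L 2 v).N) (hn : (n : ↥(unitaryGroupOfForm (conjLocal L (IsCMField.complexConj L) v) (cmLocalForm L 2 v))) ∈ cmLocalIntegralLevel L 2 (Matrix.of fun i j : Fin 2 => if i.val + j.val + 1 = 2 then (1 : L) else 0) v) :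
    (redMat ((((n : ↥(unitaryGroupOfForm (conjLocal L (IsCMField.complexConj L) v) (cmLocalForm L 2 v))) : GL (Fin 2) (LocalRing L v)).val.map
            (Pi.evalRingHom (fun w' : PlacesOver L v => w'.1.adicCompletion L) w))) - 1).rank = 0 := by
  have hle := (unipotent_mem_cmLocalIntegralLevel_iff L v w hw n).1 hn
  have hlt := valued_skew_apply_lt_one_of_ramified_of_uniformizer L v w hw he hθ hσθ
    ⟨_, umat_zero_one_mem_skewPart (conjLocal L (IsCMField.complexConj L) v) (cmLocalForm_eq_over L 2 v) n⟩ hle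
  exact (rank_redMat_unipotent_sub_one_eq_zero_iff L v w n hle).2 hlt

include hw in
/-- **THE RANK-1 LINE STRATUM IS EMPTY AT A RAMIFIED PLACE WITH AN ANTI-FIXED UNIFORMISER** (`|2|`-free). [cite: Rogawski1990, §4.9 p. 54] [cite: Kottwitz1986, §3] -/
theorem lineStratum_one_eq_empty_of_ramified_of_uniformizer (he : v.asIdeal.ramificationIdx' w.1.asIdeal ≠ 1) {θ : w.1.adicCompletion L} (hθ : Valued.v θ = WithZero.exp (-1 : ℤ))
    (hσθ : galAdicCompletionMap (L := L) (IsCMField.complexConj L) hw θ = -θ) :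
    {n : ↥(cmBorelTriple L 2 v).N | (n : ↥(unitaryGroupOfForm (conjLocal L (IsCMField.complexConj L) v) (cmLocalForm L 2 v))) ∈
          cmLocalIntegralLevel L 2 (Matrix.of fun i j : Fin 2 => if i.val + j.val + 1 = 2 then (1 : L) else 0) v ∧
        ((redMat ((((n : ↥(unitaryGroupOfForm (conjLocal L (IsCMField.complexConj L) v) (cmLocalForm L 2 v))) : GL (Fin 2) (LocalRing L v)).val.map
            (Pi.evalRingHom (fun w' : PlacesOver L v => w'.1.adicCompletion L) w))) - 1) ^ 2 = 0 ∧
          (redMat ((((n : ↥(unitaryGroupOfForm (conjLocal L (IsCMField.complexConj L) v) (cmLocalForm L 2 v))) : GL (Fin 2) (LocalRing L v)).val.map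
            (Pi.evalRingHom (fun w' : PlacesOver L v => w'.1.adicCompletion L) w))) - 1).rank = 1)} = ∅ := by
  ext n
  simp only [Set.mem_setOf_eq, Set.mem_empty_iff_false, iff_false, not_and]
  intro hn _ h1
  rw [rank_redMat_unipotent_sub_one_eq_zero_of_ramified_of_uniformizer L v w hw he hθ hσθ n hn] at h1
  exact zero_ne_one h1

include hw in
/-- **THE RANK-0 LINE STRATUM IS ALL OF `N₂ ∩ K₂` AT A RAMIFIED PLACE WITH AN ANTI-FIXED UNIFORMISER** (`|2|`-free) (`(red(n_w) − 1)² = 0` holds for every `n`, ★ FILE 1 `sq_redMat_unipotent_sub_one`). [cite: Rogawski1990, §4.9 p. 54] [cite: Kottwitz1986, §3] -/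
theorem lineStratum_zero_eq_of_ramified_of_uniformizer (he : v.asIdeal.ramificationIdx' w.1.asIdeal ≠ 1) {θ : w.1.adicCompletion L} (hθ : Valued.v θ = WithZero.exp (-1 : ℤ))
    (hσθ : galAdicCompletionMap (L := L) (IsCMField.complexConj L) hw θ = -θ) :
    {n : ↥(cmBorelTriple L 2 v).N | (n : ↥(unitaryGroupOfForm (conjLocal L (IsCMField.complexConj L) v) (cmLocalForm L 2 v))) ∈
          cmLocalIntegralLevel L 2 (Matrix.of fun i j : Fin 2 => if i.val + j.val + 1 = 2 then (1 : L) else 0) v ∧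
        ((redMat ((((n : ↥(unitaryGroupOfForm (conjLocal L (IsCMField.complexConj L) v) (cmLocalForm L 2 v))) : GL (Fin 2) (LocalRing L v)).val.map
            (Pi.evalRingHom (fun w' : PlacesOver L v => w'.1.adicCompletion L) w))) - 1) ^ 2 = 0 ∧
          (redMat ((((n : ↥(unitaryGroupOfForm (conjLocal L (IsCMField.complexConj L) v) (cmLocalForm L 2 v))) : GL (Fin 2) (LocalRing L v)).val.map
            (Pi.evalRingHom (fun w' : PlacesOver L v => w'.1.adicCompletion L) w))) - 1).rank = 0)} =
      {n : ↥(cmBorelTriple L 2 v).N | (n : ↥(unitaryGroupOfForm (conjLocal L (IsCMField.complexConj L) v) (cmLocalForm L 2 v))) ∈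
          cmLocalIntegralLevel L 2 (Matrix.of fun i j : Fin 2 => if i.val + j.val + 1 = 2 then (1 : L) else 0) v} := by
  ext n
  simp only [Set.mem_setOf_eq]
  exact ⟨fun h => h.1, fun hn => ⟨hn, sq_redMat_unipotent_sub_one L v w n, rank_redMat_unipotent_sub_one_eq_zero_of_ramified_of_uniformizer L v w hw he hθ hσθ n hn⟩⟩

include hw in
/-- **RANK 1 LINE STRATUM AT A RAMIFIED PLACE WITH AN ANTI-FIXED UNIFORMISER: measure `0`** (the set is empty), for EVERY measure on `N₂`. [cite: Rogawski1990, §4.9 p. 54] -/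
theorem measureReal_lineStratum_one_of_ramified_of_uniformizer [MeasurableSpace ↥(cmBorelTriple L 2 v).N] (μN : Measure ↥(cmBorelTriple L 2 v).N)
    (he : v.asIdeal.ramificationIdx' w.1.asIdeal ≠ 1) {θ : w.1.adicCompletion L} (hθ : Valued.v θ = WithZero.exp (-1 : ℤ))
    (hσθ : galAdicCompletionMap (L := L) (IsCMField.complexConj L) hw θ = -θ) :
    μN.real {n : ↥(cmBorelTriple L 2 v).N | (n : ↥(unitaryGroupOfForm (conjLocal L (IsCMField.complexConj L) v) (cmLocalForm L 2 v))) ∈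
          cmLocalIntegralLevel L 2 (Matrix.of fun i j : Fin 2 => if i.val + j.val + 1 = 2 then (1 : L) else 0) v ∧
        ((redMat ((((n : ↥(unitaryGroupOfForm (conjLocal L (IsCMField.complexConj L) v) (cmLocalForm L 2 v))) : GL (Fin 2) (LocalRing L v)).val.map
            (Pi.evalRingHom (fun w' : PlacesOver L v => w'.1.adicCompletion L) w))) - 1) ^ 2 = 0 ∧
          (redMat ((((n : ↥(unitaryGroupOfForm (conjLocal L (IsCMField.complexConj L) v) (cmLocalForm L 2 v))) : GL (Fin 2) (LocalRing L v)).val.map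
            (Pi.evalRingHom (fun w' : PlacesOver L v => w'.1.adicCompletion L) w))) - 1).rank = 1)} = 0 := by
  rw [lineStratum_one_eq_empty_of_ramified_of_uniformizer L v w hw he hθ hσθ, measureReal_empty]

include hw in
/-- **RANK 0 LINE STRATUM AT A RAMIFIED PLACE WITH AN ANTI-FIXED UNIFORMISER: the whole of `N₂ ∩ K₂`**, for EVERY measure on `N₂` (inert twin: `q⁻¹·μ(N₂ ∩ K₂)`, ★ `measureReal_lineStratum_zero`).
[cite: Rogawski1990, §4.9 p. 54] -/
theorem measureReal_lineStratum_zero_of_ramified_of_uniformizer [MeasurableSpace ↥(cmBorelTriple L 2 v).N] (μN : Measure ↥(cmBorelTriple L 2 v).N)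
    (he : v.asIdeal.ramificationIdx' w.1.asIdeal ≠ 1) {θ : w.1.adicCompletion L} (hθ : Valued.v θ = WithZero.exp (-1 : ℤ))
    (hσθ : galAdicCompletionMap (L := L) (IsCMField.complexConj L) hw θ = -θ) :
    μN.real {n : ↥(cmBorelTriple L 2 v).N | (n : ↥(unitaryGroupOfForm (conjLocal L (IsCMField.complexConj L) v) (cmLocalForm L 2 v))) ∈
          cmLocalIntegralLevel L 2 (Matrix.of fun i j : Fin 2 => if i.val + j.val + 1 = 2 then (1 : L) else 0) v ∧
        ((redMat ((((n : ↥(unitaryGroupOfForm (conjLocal L (IsCMField.complexConj L) v) (cmLocalForm L 2 v))) : GL (Fin 2) (LocalRing L v)).val.map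
            (Pi.evalRingHom (fun w' : PlacesOver L v => w'.1.adicCompletion L) w))) - 1) ^ 2 = 0 ∧
          (redMat ((((n : ↥(unitaryGroupOfForm (conjLocal L (IsCMField.complexConj L) v) (cmLocalForm L 2 v))) : GL (Fin 2) (LocalRing L v)).val.map
            (Pi.evalRingHom (fun w' : PlacesOver L v => w'.1.adicCompletion L) w))) - 1).rank = 0)} =
      μN.real {n : ↥(cmBorelTriple L 2 v).N | (n : ↥(unitaryGroupOfForm (conjLocal L (IsCMField.complexConj L) v) (cmLocalForm L 2 v))) ∈
          cmLocalIntegralLevel L 2 (Matrix.of fun i j : Fin 2 => if i.val + j.val + 1 = 2 then (1 : L) else 0) v} := by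
  rw [lineStratum_zero_eq_of_ramified_of_uniformizer L v w hw he hθ hσθ]

end Literature.NumberTheory.Automorphic.UnitaryGroup

end
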